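import Summits.QuantumFields.BalabanUV.T4Continuum.E3Cert.E3PolyCertZPoly

/-!
# E3 lean-draft (SPARSE-MONOMIAL, INTEGER-COEFFICIENT variant E3Z: all kernel arithmetic in ℤ — no ℚ normalisation in the kernel): kernel replay of an E3 matrix-Putinar certificate as ONE scalar polynomial identity (lane balaban-calc, engine E3)

DRAFT under `run/shared/lean/ttrl/balaban-calc/e3/lean-draft/` — NOT a tree file (handed to ttrl2).  Object: for the block operator
`H(x)` of B4 CMP 89 (1.3)–(1.6) (entries polynomial in the free-link quaternion coordinates `x`), the certificate JSON
`e3/certs/<name>.json` (schema v3/v4, verified by `bal_e3_verify.py`) is re-encoded by `bal_e3_lean_emit.py` as data and the claim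
becomes the polynomial identity in the variables `X = (x, v)` (`v` = a test vector of length `dim`):

  `vᵀ H(x) v − γ |v|²  =  Σ_k D_k · ℓ_k(x,v)²  +  Σ_t g_t(x) · Σ_k D'_{t,k} · ℓ'_{t,k}(v)²  +  Σ_t (|x_t|² − 1) · W_t(x,v)`      (★)

with `D_k, D'_{t,k} ≥ 0`, `ℓ, ℓ'` explicit polynomials with rational coefficients, `g_t` the small-field hypotheses and `W_t` free.
On `{|x_t|² = 1 ∀t, g_t ≥ 0 ∀t}` the right-hand side of (★) is `≥ 0`, i.e. `vᵀH(x)v ≥ γ|v|²` for every `v`: `λ_min(H(x)) ≥ γ`.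

KERNEL CHECK (`decide +kernel` on literal data; no `native_decide`, no axioms): `PolyCert.check c = true`, where `check` expands both sides
of (★) into sparse polynomials over ℚ, merge-sorts the residual LHS − RHS with coefficient accumulation (fuelled structural recursion) and tests
that every coefficient is 0, and tests `D ≥ 0`.  SOUNDNESS `PolyCert.check_sound` is PROVED below (no sorry):
`check c = true → ∀ X, (∀ t, sphere_t(X) = 0) → (∀ t, 0 ≤ g_t(X)) → 0 ≤ eval X (lhs c)`, and `eval X (lhs c) = eval X c.quadH − γ·eval X c.vSq`.
-/

set_option autoImplicit false
/-! TREE COPY (substrate cell E3 PILOT, typer ruling (μ3), journal l.19196): part 3∕3 = the SOUNDNESS THEOREMS (`PolyCert.check_sound`, `allBelow`, `GramCert.blockCert_sound`, `GramCert.main_sound`, `GramCert.main_sound_sliced`) of the lane checker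
`run/shared/lean/ttrl/balaban-calc/e3/lean-draft/tree/E3PolyCertZ.lean` (split at namespace seams for the tree's 400-line rule; one-line docstrings
added by script to undocumented declarations; NO other edit — in particular no literal, definition body or proof is changed).  HONEST: a
certificate CHECKER; the mathematics it serves is certified computation on small blocks ([B4] (1.3)–(1.6) block forms) — NOT Prop. (1.8), NOT an
input of any NE row today, NOT infinite volume ∕ mass gap ∕ Clay. -/

namespace E3Z

/-- SOUNDNESS: a passing kernel check makes (★) an identity of real polynomial functions with a nonnegative right-hand side on the
semialgebraic set; hence `0 ≤ vᵀH(x)v − γ|v|²` there (as encoded in `lhs`). -/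
theorem PolyCert.check_sound (c : PolyCert) (h : c.check = true) (X : ℕ → ℝ)
    (hsph : ∀ ew ∈ c.eq, Poly.eval X ew.1 = 0) (hin : ∀ gi ∈ c.ineq, 0 ≤ Poly.eval X gi.1) :
    0 ≤ Poly.eval X c.lhs := by
  simp only [PolyCert.check, PolyCert.nonnegD, Bool.and_eq_true] at h
  obtain ⟨⟨hD, hDI⟩, hz⟩ := h
  have hres := Poly.isZero_sound X _ hz
  rw [Poly.eval_add, Poly.eval_neg] at hres
  have : Poly.eval X c.lhs = Poly.eval X c.rhs := by linarith
  rw [this, PolyCert.rhs, Poly.eval_add, Poly.eval_add]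
  have h1 := Poly.eval_sqSum_nonneg X c.sos hD
  have h2 := Poly.eval_ineqSum_nonneg X c.ineq hDI hin
  have h3 := Poly.eval_eqSum_zero X c.eq hsph
  linarith

/-- what `lhs` means: `eval lhs = eval quadH − γ · eval vSq` (`quadH` = vᵀH(x)v, `vSq` = |v|², by the emitter's construction). -/
theorem PolyCert.eval_lhs (c : PolyCert) (X : ℕ → ℝ) :
    Poly.eval X c.lhs = Poly.eval X c.quadH - (c.gamma : ℝ) * Poly.eval X c.vSq := by
  simp only [PolyCert.lhs, Poly.eval_add, Poly.eval_smul]; push_cast; ring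

/-- assembly helper for generated files: extend «∀ k < n, P k» by one case (no `interval_cases`, no unfolding) -/
theorem allBelow (P : ℕ → Prop) (n : ℕ) (h : ∀ k, k < n → P k) (hn : P n) : ∀ k, k < n + 1 → P k := by
  intro k hk
  by_cases hkn : k = n
  · subst hkn; exact hn
  · exact h k (by omega)
/-- E3Z checker (soundness): `allBelowZero` (lane output, transcribed verbatim; see the module docstring). -/
theorem allBelowZero (P : ℕ → Prop) : ∀ k, k < 0 → P k := fun k hk => absurd hk (Nat.not_lt_zero k)

/-! ## Chunked soundness (integer version) -/
namespace GramCert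
variable (X : ℕ → ℝ)

/-- E3Z checker (soundness): `blockCert_sound` (lane output, transcribed verbatim; see the module docstring). -/
theorem blockCert_sound (nx : ℕ) (basis : List Mono) (b : GramBlock) (h : (blockCert nx basis b).check = true) :
    0 ≤ Poly.eval X (bilinear nx basis b) := by
  have h1 := PolyCert.check_sound (blockCert nx basis b) h X (by simp [blockCert]) (by simp [blockCert])
  have h2 : Poly.eval X (blockCert nx basis b).lhs = ((4 : ℤ) ^ b.lden : ℤ) * Poly.eval X (bilinear nx basis b) := by
    simp [PolyCert.lhs, blockCert, PolyCert.vSq, Poly.eval_add, Poly.eval_smul, Poly.eval]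
  rw [h2] at h1
  have h4 : (0 : ℝ) < ((4 : ℤ) ^ b.lden : ℤ) := by exact_mod_cast pow_pos (by norm_num) _
  exact nonneg_of_mul_nonneg_right (by simpa [mul_comm] using h1) h4

/-- E3Z checker (soundness): `eval_blocksBil_nonneg` (lane output, transcribed verbatim; see the module docstring). -/
theorem eval_blocksBil_nonneg (nx : ℕ) (basis : List Mono) (l : List (GramBlock × ℕ))
    (h : ∀ i, i < l.length → (blockCert nx basis (l.getD i (⟨[], 0, [], 0, []⟩, 0)).1).check = true) :
    0 ≤ Poly.eval X (blocksBil nx basis l) := by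
  induction l with
  | nil => simp [blocksBil, Poly.eval]
  | cons b l ih =>
    simp only [blocksBil, Poly.eval_append, Poly.eval_smul]
    have h0 := h 0 (by simp)
    simp only [List.getD_cons_zero] at h0
    have hl : ∀ i, i < l.length → (blockCert nx basis (l.getD i (⟨[], 0, [], 0, []⟩, 0)).1).check = true := by
      intro i hi; have := h (i + 1) (by simpa using hi); simpa using this
    have hb := blockCert_sound X nx basis b.1 h0
    have : (0:ℝ) ≤ (b.2 : ℤ) := by exact_mod_cast Nat.zero_le _
    exact add_nonneg (mul_nonneg (by exact_mod_cast Nat.zero_le _) hb) (ih hl)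

/-- E3Z checker (soundness): `eval_ineqBil_nonneg` (lane output, transcribed verbatim; see the module docstring). -/
theorem eval_ineqBil_nonneg (nx : ℕ) (basis : List Mono) (l : List (Poly × GramBlock × ℕ))
    (h : ∀ i, i < l.length → (blockCert nx basis (l.getD i ([], ⟨[], 0, [], 0, []⟩, 0)).2.1).check = true)
    (hin : ∀ gi ∈ l, 0 ≤ Poly.eval X gi.1) : 0 ≤ Poly.eval X (ineqBil nx basis l) := by
  induction l with
  | nil => simp [ineqBil, Poly.eval]
  | cons gb l ih =>
    simp only [ineqBil, Poly.eval_append, Poly.eval_smul, Poly.eval_mul]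
    have h0 := h 0 (by simp)
    simp only [List.getD_cons_zero] at h0
    have hl : ∀ i, i < l.length → (blockCert nx basis (l.getD i ([], ⟨[], 0, [], 0, []⟩, 0)).2.1).check = true := by
      intro i hi; have := h (i + 1) (by simpa using hi); simpa using this
    have hb := blockCert_sound X nx basis gb.2.1 h0
    exact add_nonneg (mul_nonneg (by exact_mod_cast Nat.zero_le _) (mul_nonneg (hin gb (by simp)) hb)) (ih hl (fun g hg => hin g (by simp [hg])))

/-- E3Z checker (soundness): `eval_ineqBil_R` (lane output, transcribed verbatim; see the module docstring). -/
theorem eval_ineqBil_R (nx : ℕ) (basis : List Mono) (l : List (Poly × GramBlock × ℕ)) :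
    Poly.eval X (ineqBil nx basis (ineqR l)) = Poly.eval X (ineqBil nx basis l) := by
  induction l with
  | nil => simp [ineqR, ineqBil]
  | cons t l ih => simp only [ineqR, List.map_cons, ineqBil, Poly.eval_append, Poly.eval_smul, Poly.eval_mul, Poly.eval_renorm] at ih ⊢; rw [ih]

/-- E3Z checker (soundness): `eval_eqESum_zero` (lane output, transcribed verbatim; see the module docstring). -/
theorem eval_eqESum_zero (l : List (Poly × Poly × Poly))
    (hE : ∀ i, i < l.length → eqCheck (l.getD i ([], [], [])) = true) (hsph : ∀ t ∈ l, Poly.eval X t.1 = 0) :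
    Poly.eval X (eqESum l) = 0 := by
  induction l with
  | nil => simp [eqESum, Poly.eval]
  | cons t l ih =>
    simp only [eqESum, Poly.eval_append, Poly.eval_renorm]
    have h0 := hE 0 (by simp)
    simp only [List.getD_cons_zero, eqCheck] at h0
    have hz := Poly.isZero_sound X _ h0
    simp only [Poly.eval_add, Poly.eval_mul, Poly.eval_neg, Poly.eval_renorm] at hz
    have ht : Poly.eval X t.1 = 0 := hsph t (by simp)
    rw [ht, zero_mul] at hz
    have hl : ∀ i, i < l.length → eqCheck (l.getD i ([], [], [])) = true := by
      intro i hi; have := hE (i + 1) (by simpa using hi); simpa using this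
    rw [ih hl (fun u hu => hsph u (by simp [hu]))]
    linarith

/-- CHUNKED SOUNDNESS (integer format): main identity + per-block certificates + hypotheses ⇒ 0 ≤ quadH − gamma·Σv²  (= M·(vᵀHv − γ|v|²)). -/
theorem main_sound (gc : GramCert) (hmain : mainCheck gc = true)
    (hb : ∀ i, i < gc.blocks.length → (blockCert gc.nx gc.basis (gc.blocks.getD i (⟨[], 0, [], 0, []⟩, 0)).1).check = true)
    (hs : ∀ i, i < gc.ineq.length → (blockCert gc.nx gc.basis (gc.ineq.getD i ([], ⟨[], 0, [], 0, []⟩, 0)).2.1).check = true)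
    (he : ∀ i, i < gc.eq.length → eqCheck (gc.eq.getD i ([], [], [])) = true)
    (hsph : ∀ ew ∈ gc.eq, Poly.eval X ew.1 = 0) (hin : ∀ gi ∈ gc.ineq, 0 ≤ Poly.eval X gi.1) :
    0 ≤ Poly.eval X gc.quadH - (gc.gamma : ℝ) * Poly.eval X ((List.range gc.dim).map (fun i => ([(gc.nx + i, 2)], (1 : ℤ)))) := by
  have hz := Poly.isZero_sound X _ hmain
  simp only [mainResidual, Poly.eval_add, Poly.eval_neg, Poly.eval_smul, Poly.eval_renorm, eval_ineqBil_R] at hz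
  have h1 := eval_blocksBil_nonneg X gc.nx gc.basis gc.blocks hb
  have h2 := eval_ineqBil_nonneg X gc.nx gc.basis gc.ineq hs hin
  have h3 := eval_eqESum_zero X gc.eq he hsph
  push_cast at hz
  simp only [add_zero] at hz
  linarith

/-- CHUNKED + SLICED SOUNDNESS (integer format): sliced main identity + per-block certificates + hypotheses ⇒ 0 ≤ quadH − gamma·Σv²  (= M·(vᵀHv − γ|v|²)). -/
theorem main_sound_sliced (gc : GramCert) (hmain : ∀ k, k < gc.dim + 1 → mainSlice gc k = true)
    (hb : ∀ i, i < gc.blocks.length → (blockCert gc.nx gc.basis (gc.blocks.getD i (⟨[], 0, [], 0, []⟩, 0)).1).check = true)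
    (hs : ∀ i, i < gc.ineq.length → (blockCert gc.nx gc.basis (gc.ineq.getD i ([], ⟨[], 0, [], 0, []⟩, 0)).2.1).check = true)
    (he : ∀ i, i < gc.eq.length → eqCheck (gc.eq.getD i ([], [], [])) = true)
    (hsph : ∀ ew ∈ gc.eq, Poly.eval X ew.1 = 0) (hin : ∀ gi ∈ gc.ineq, 0 ≤ Poly.eval X gi.1) :
    0 ≤ Poly.eval X gc.quadH - (gc.gamma : ℝ) * Poly.eval X ((List.range gc.dim).map (fun i => ([(gc.nx + i, 2)], (1 : ℤ)))) := by
  have hz := Poly.eval_zero_of_slices X gc.nx gc.dim (mainResidual gc) hmain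
  simp only [mainResidual, Poly.eval_add, Poly.eval_neg, Poly.eval_smul, Poly.eval_renorm, eval_ineqBil_R] at hz
  have h1 := eval_blocksBil_nonneg X gc.nx gc.basis gc.blocks hb
  have h2 := eval_ineqBil_nonneg X gc.nx gc.basis gc.ineq hs hin
  have h3 := eval_eqESum_zero X gc.eq he hsph
  push_cast at hz
  simp only [add_zero] at hz
  linarith


end GramCert

end E3Z
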